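import Summits.AtomisticToContinuum.HydrodynamicLimit.Theorems.EnskogAdjointDualityAdjointEnskogTestFamilyRKappaOperator
import Summits.AtomisticToContinuum.HydrodynamicLimit.Theorems.EnskogAdjointDualityAdjointEnskogTestFamilyRDualitySlice
import Summits.AtomisticToContinuum.HydrodynamicLimit.Theorems.EnskogAdjointDualityAdjointEnskogTestFamilyRHalfGaussian
import Summits.AtomisticToContinuum.HydrodynamicLimit.Theorems.EnskogAdjointDualityAdjointEnskogTestFamilyRSphereCalculus
import HarnessLib

/-!
# K2R refutation, stub `operatorKappaZero` — preparation: the dual gain kernel on `S² × ℝ³`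

Route `EnskogAdjointDuality` of `AtomisticToContinuum/HydrodynamicLimit`, crux K2R
`AdjointEnskogTestFamilyR` (stmt-AtomisticToContinuum-11592), line `refutation`, registered stub
`stub_operatorKappaZero` (identity (0) for the corrector part of the test function). Measure-theoretic
plumbing around the explicit dual gain kernel `I₀^R(U, n) = ½ e^{-(|U|²-⟪U,n⟫²)/2} h(⟪U,n⟫) Θ̄₀^R(⟪U,n⟫²)`
of the landed stub `stub_dualitySlice` (passed as a variable `I` with its defining equation `hI`; the
critical weight `Θ₀^R(v) = (1+|v|²)⁻³e^{-|v|²/R}` is the variable `Θ`, equation `hΘ`):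
joint continuity (`k2r_ref_ok0_continuous_I`); the uniform bound `∫ (1+|U|²) I₀^R(U, ω) dU ≤ B_R` and
integrability of `(ω, U) ↦ (1+|U|²) I₀^R(U, ω)` on `σ ⊗ dU` (`k2r_ref_ok0_integrable_SV`); the weighted
Fubini exchange `∫_{S²} c ∫ F I₀ dU dσ = ∫ F ∫_{S²} c I₀ dσ dU` (`k2r_ref_ok0_fubini_SV`); the triple
exchange `∫ Θ₀^R(v) ∫∫ ((v-w)·ω)₊ M(w) K(ω, w') = ∫_{S²} ∫ K(ω, U) I₀^R(U, ω) dU dσ` (`k2r_ref_ok0_triple`);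
and the keyed sub-goal `stub_operatorKappaZero_prep` (`|sin y − y| ≤ |y|³/6`).

References: C. Cercignani, R. Illner, M. Pulvirenti, *The Mathematical Theory of Dilute Gases* (1994),
§3.1 (1.7)–(1.9) [CIP1994].
-/
noncomputable section

open MeasureTheory Set Filter Function
open scoped InnerProductSpace Real

namespace Summit.AtomisticToContinuum.HydrodynamicLimit.Theorems.EnskogAdjointDuality

open Literature.MathematicalPhysics.KineticTheory Literature.Analysis.FluidPDE Literature.Analysis.FunctionSpaces

variable {Θ : ℝ → V3 → ℝ} {I : ℝ → V3 → V3 → ℝ}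
variable (hΘ : ∀ R v, Θ R v = ((1 + ‖v‖ ^ 2) ^ 3)⁻¹ * Real.exp (-‖v‖ ^ 2 / R))
  (hI : ∀ R U n, I R U n = (1 / 2 : ℝ) * Real.exp (-(‖U‖ ^ 2 - ⟪U, n⟫_ℝ ^ 2) / 2) *
    (∫ b, max (⟪U, n⟫_ℝ - b) 0 * (Real.exp (-b ^ 2 / 2) / Real.sqrt (2 * π))) *
    ∫ E in Ioi (⟪U, n⟫_ℝ ^ 2), ((1 + E) ^ 3)⁻¹ * Real.exp (-E / R))
include hΘ hI

omit hΘ in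
/-- Joint continuity of the dual gain kernel `(U, n) ↦ I₀^R(U, n)` (`h` is continuous by
`stub_halfGaussian`, the tail is continuous on `[0, ∞)`). [folklore] -/
theorem k2r_ref_ok0_continuous_I {R : ℝ} (hR : 0 < R) :
    Continuous fun p : V3 × V3 => I R p.1 p.2 := by
  have hh : Continuous fun a : ℝ => ∫ b, max (a - b) 0 * (Real.exp (-b ^ 2 / 2) / Real.sqrt (2 * π)) :=
    stub_halfGaussian.1.1
  have hth : IntegrableOn (fun E : ℝ => ((1 + E) ^ 3)⁻¹ * Real.exp (-E / R)) (Ioi 0) :=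
    (k2r_ref_integrableOn_moment hR (Nat.zero_le 3)).congr_fun (fun E _ =>
      show E ^ 0 * ((1 + E) ^ 3)⁻¹ * Real.exp (-E / R) = ((1 + E) ^ 3)⁻¹ * Real.exp (-E / R) by
        rw [pow_zero, one_mul]) measurableSet_Ioi
  have hT : ContinuousOn (fun x : ℝ => ∫ E in Ioi x, ((1 + E) ^ 3)⁻¹ * Real.exp (-E / R)) (Ici 0) :=
    hth.continuousOn_Ici_primitive_Ioi
  have hin : Continuous fun p : V3 × V3 => ⟪p.1, p.2⟫_ℝ := continuous_fst.inner continuous_snd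
  have h1 : Continuous fun p : V3 × V3 =>
      ∫ E in Ioi (⟪p.1, p.2⟫_ℝ ^ 2), ((1 + E) ^ 3)⁻¹ * Real.exp (-E / R) :=
    hT.comp_continuous (hin.pow 2) fun p => mem_Ici.2 (sq_nonneg _)
  have h2 : Continuous fun p : V3 × V3 =>
      (1 / 2 : ℝ) * Real.exp (-(‖p.1‖ ^ 2 - ⟪p.1, p.2⟫_ℝ ^ 2) / 2) := by fun_prop
  simp only [hI]
  exact (h2.mul (hh.comp hin)).mul h1

omit hΘ in
/-- Continuity of the dual gain kernel on `S² × ℝ³` and of its sphere sections. [folklore] -/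
theorem k2r_ref_ok0_continuous_I' {R : ℝ} (hR : 0 < R) :
    (Continuous fun p : Metric.sphere (0 : V3) 1 × V3 => I R p.2 p.1) ∧
    ∀ U : V3, Continuous fun ω : Metric.sphere (0 : V3) 1 => I R U ω := by
  have hIc := k2r_ref_ok0_continuous_I hI hR
  have h1 : Continuous ((fun p : V3 × V3 => I R p.1 p.2) ∘
      fun p : Metric.sphere (0 : V3) 1 × V3 => (p.2, (p.1 : V3))) :=
    hIc.comp (continuous_snd.prodMk (continuous_subtype_val.comp continuous_fst))
  have h2 : ∀ U : V3, Continuous ((fun p : V3 × V3 => I R p.1 p.2) ∘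
      fun ω : Metric.sphere (0 : V3) 1 => (U, (ω : V3))) := fun U =>
    hIc.comp (continuous_const.prodMk continuous_subtype_val)
  exact ⟨h1, h2⟩

/-- The duality per impact direction (`stub_dualitySlice`) for the critical weight, in the
notation of this file: integrability of the gain integrand on `ℝ³ × ℝ³`, of `F I₀` on `ℝ³`, the swap
formula `∫ Θ₀ ∫ ((v-w)·ν)₊ M F(w') = ∫ F I₀`, and `I₀ ≥ 0`. [cite: CIP1994, §3.1 (1.7)–(1.9)] -/
theorem k2r_ref_ok0_duality {R : ℝ} (hR : 1 ≤ R) (ν : Metric.sphere (0 : V3) 1) {F : V3 → ℝ}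
    (hF : Measurable F) {CF : ℝ} (hCF : ∀ U, |F U| ≤ CF * (1 + ‖U‖ ^ 2)) :
    Integrable (fun p : V3 × V3 => Θ R p.1 *
        (max ⟪p.1 - p.2, (ν : V3)⟫_ℝ 0 * globalMaxwellian p.2 *
          F (p.2 + ⟪p.1 - p.2, (ν : V3)⟫_ℝ • (ν : V3)))) ∧
    Integrable (fun U : V3 => F U * I R U ν) ∧
    (∫ v : V3, Θ R v * ∫ w : V3, max ⟪v - w, (ν : V3)⟫_ℝ 0 * globalMaxwellian w *
        F (w + ⟪v - w, (ν : V3)⟫_ℝ • (ν : V3))) = ∫ U : V3, F U * I R U ν ∧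
    (∀ U : V3, 0 ≤ I R U ν) := by
  have h := stub_dualitySlice R hR ν F hF CF hCF
  simp only [hΘ, hI]
  exact ⟨h.1, h.2.1, h.2.2.1, fun U => (h.2.2.2.2.2.2 U).1⟩

omit hI in
/-- The critical weight: nonnegative, at most `1`, continuous, `(1+|v|²)²Θ₀^R ∈ L¹` and
`(1+|v|²)⁴ Θ₀^R ∈ L¹`. [folklore] -/
theorem k2r_ref_ok0_w_facts {R : ℝ} (hR : 1 ≤ R) :
    (∀ v, 0 ≤ Θ R v ∧ Θ R v ≤ 1) ∧ (Continuous fun v => Θ R v) ∧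
    Integrable (fun v : V3 => (1 + ‖v‖ ^ 2) ^ 2 * Θ R v) ∧
    Integrable (fun v : V3 => Θ R v * (1 + ‖v‖ ^ 2) ^ 4) := by
  have hR0 : 0 < R := by linarith
  simp only [hΘ]
  refine ⟨fun v => ?_, ?_, (k2r_ref_weight0 hR0).2, (k2r_ref_R3_facts hR).2.2.2.2.2.2.2.2⟩
  swap
  · exact (((continuous_const.add (continuous_norm.pow 2)).pow 3).inv₀
      (fun v => (pow_pos (by positivity : (0:ℝ) < 1 + ‖v‖ ^ 2) 3).ne')).mul (by fun_prop)
  have h := k2r_ref_th0_bounds hR0 (sq_nonneg ‖v‖)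
  exact ⟨h.1, h.2.trans (inv_le_one_of_one_le₀ (one_le_pow₀ (by nlinarith [sq_nonneg ‖v‖])))⟩

/-- `I₀^R ≥ 0`. [folklore] -/
theorem k2r_ref_ok0_I_nonneg {R : ℝ} (hR : 1 ≤ R) (ν : Metric.sphere (0 : V3) 1) (U : V3) :
    0 ≤ I R U ν :=
  (k2r_ref_ok0_duality hΘ hI hR ν (F := fun _ => (0 : ℝ)) measurable_const (CF := 0)
    (fun U => by rw [abs_zero, zero_mul])).2.2.2 U

omit hΘ hI in
/-- `(1 + a)³ ≤ 4 (1 + a²)²` for `a ≥ 0`. [folklore] -/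
theorem k2r_ref_ok0_cube_le {a : ℝ} (ha : 0 ≤ a) : (1 + a) ^ 3 ≤ 4 * (1 + a ^ 2) ^ 2 := by
  have h2 : (1 + a) ^ 2 ≤ 2 * (1 + a ^ 2) := by nlinarith [sq_nonneg (a - 1)]
  calc (1 + a) ^ 3 ≤ (1 + a) ^ 3 * (1 + a) := le_mul_of_one_le_right (by positivity) (by linarith)
    _ = ((1 + a) ^ 2) ^ 2 := by ring
    _ ≤ (2 * (1 + a ^ 2)) ^ 2 := pow_le_pow_left₀ (by positivity) h2 2
    _ = 4 * (1 + a ^ 2) ^ 2 := by ring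

/-- **Uniform bound per impact direction.** For every `ω ∈ S²`, `(1+|U|²) I₀^R(U, ω)` is integrable
on `ℝ³` with `0 ≤ ∫ (1+|U|²) I₀^R(U, ω) dU ≤ K₃ · ∫ 4(1+|v|²)² Θ₀^R(v) dv`, `K₃ = ∫ (1+|w|)³ M` (the
duality read backwards and `((v-w)·ω)₊ M(w) (1+|w'|²) ≤ (1+|v|)³ (1+|w|)³ M(w)`). [folklore] -/
theorem k2r_ref_ok0_Q_le {R : ℝ} (hR : 1 ≤ R) (ω : Metric.sphere (0 : V3) 1) :
    Integrable (fun U : V3 => (1 + ‖U‖ ^ 2) * I R U ω) ∧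
    0 ≤ ∫ U : V3, (1 + ‖U‖ ^ 2) * I R U ω ∧
    ∫ U : V3, (1 + ‖U‖ ^ 2) * I R U ω ≤
      (∫ w : V3, (1 + ‖w‖) ^ 3 * globalMaxwellian w) *
        ∫ v : V3, 4 * ((1 + ‖v‖ ^ 2) ^ 2 * Θ R v) := by
  obtain ⟨-, hFI, hdual, hI0⟩ := k2r_ref_ok0_duality hΘ hI hR ω (F := fun U : V3 => 1 + ‖U‖ ^ 2)
    (by fun_prop) (CF := 1) (fun U => by rw [abs_of_nonneg (by positivity), one_mul])
  obtain ⟨hw01, -, hw2, -⟩ := k2r_ref_ok0_w_facts hΘ hR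
  refine ⟨hFI, integral_nonneg fun U => mul_nonneg (by positivity) (hI0 U), ?_⟩
  beta_reduce at hdual
  rw [← hdual]
  set K₃ : ℝ := ∫ w : V3, (1 + ‖w‖) ^ 3 * globalMaxwellian w
  have hW : Integrable (fun w : V3 => (1 + ‖w‖) ^ 3 * globalMaxwellian w) :=
    Literature.Analysis.UnboundedOperators.integrable_one_add_norm_pow_mul_globalMaxwellian 3
  have hK₃0 : 0 ≤ K₃ := integral_nonneg fun w =>
    mul_nonneg (pow_nonneg (by positivity) 3) (globalMaxwellian_pos w).le
  have hinner : ∀ v : V3, ∫ w : V3, max ⟪v - w, (ω : V3)⟫_ℝ 0 * globalMaxwellian w *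
      (1 + ‖w + ⟪v - w, (ω : V3)⟫_ℝ • (ω : V3)‖ ^ 2) ≤ (1 + ‖v‖) ^ 3 * K₃ := by
    intro v
    calc ∫ w : V3, max ⟪v - w, (ω : V3)⟫_ℝ 0 * globalMaxwellian w *
          (1 + ‖w + ⟪v - w, (ω : V3)⟫_ℝ • (ω : V3)‖ ^ 2)
        ≤ ∫ w : V3, (1 + ‖v‖) ^ 3 * ((1 + ‖w‖) ^ 3 * globalMaxwellian w) := by
          refine integral_mono_of_nonneg (Eventually.of_forall fun w => ?_) (hW.const_mul _)
            (Eventually.of_forall fun w => ?_)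
          · have := (globalMaxwellian_pos w).le
            positivity
          · have hx : |1 + ‖w + ⟪v - w, (ω : V3)⟫_ℝ • (ω : V3)‖ ^ 2| ≤ 1 * (1 + ‖v‖ ^ 2 + ‖w‖ ^ 2) := by
              rw [abs_of_nonneg (by positivity), one_mul]
              linarith [(k2r_ref_ko_norm_sq_out_le v w ω).2]
            have h := k2r_ref_ko_piece_abs_le v w ω zero_le_one hx
            rw [one_mul] at h
            exact (le_abs_self _).trans h
      _ = (1 + ‖v‖) ^ 3 * K₃ := integral_const_mul _ _
  clear_value K₃
  calc ∫ v : V3, Θ R v * ∫ w : V3, max ⟪v - w, (ω : V3)⟫_ℝ 0 * globalMaxwellian w *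
          (1 + ‖w + ⟪v - w, (ω : V3)⟫_ℝ • (ω : V3)‖ ^ 2)
      ≤ ∫ v : V3, K₃ * (4 * ((1 + ‖v‖ ^ 2) ^ 2 * Θ R v)) := by
        refine integral_mono_of_nonneg (Eventually.of_forall fun v => ?_) ((hw2.const_mul 4).const_mul K₃)
          (Eventually.of_forall fun v => ?_)
        · refine mul_nonneg (hw01 v).1 (integral_nonneg fun w => ?_)
          have := (globalMaxwellian_pos w).le
          positivity
        · have hc := k2r_ref_ok0_cube_le (norm_nonneg v)
          calc Θ R v * ∫ w : V3, max ⟪v - w, (ω : V3)⟫_ℝ 0 * globalMaxwellian w *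
                (1 + ‖w + ⟪v - w, (ω : V3)⟫_ℝ • (ω : V3)‖ ^ 2)
              ≤ Θ R v * ((1 + ‖v‖) ^ 3 * K₃) :=
                mul_le_mul_of_nonneg_left (hinner v) (hw01 v).1
            _ ≤ Θ R v * ((4 * (1 + ‖v‖ ^ 2) ^ 2) * K₃) := by gcongr; exact (hw01 v).1
            _ = K₃ * (4 * ((1 + ‖v‖ ^ 2) ^ 2 * Θ R v)) := by ring
    _ = K₃ * ∫ v : V3, 4 * ((1 + ‖v‖ ^ 2) ^ 2 * Θ R v) :=
        integral_const_mul K₃ (fun v : V3 => 4 * ((1 + ‖v‖ ^ 2) ^ 2 * Θ R v))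

/-- **Integrability of `(ω, U) ↦ (1+|U|²) I₀^R(U, ω)` on `σ ⊗ dU`** (continuity, the sections are
integrable, and the section integrals are bounded uniformly in `ω`; `σ(S²) < ∞`). [folklore] -/
theorem k2r_ref_ok0_integrable_SV {R : ℝ} (hR : 1 ≤ R) :
    Integrable (fun p : Metric.sphere (0 : V3) 1 × V3 => (1 + ‖p.2‖ ^ 2) * I R p.2 p.1)
      ((sphereMeasure : Measure (Metric.sphere (0 : V3) 1)).prod volume) := by
  haveI := isFiniteMeasure_sphereMeasure (E := V3)
  have hR0 : 0 < R := by linarith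
  have hIc := (k2r_ref_ok0_continuous_I' hI hR0).1
  have h1 : Continuous fun p : Metric.sphere (0 : V3) 1 × V3 => 1 + ‖p.2‖ ^ 2 := by fun_prop
  have hc : Continuous fun p : Metric.sphere (0 : V3) 1 × V3 =>
      (1 + ‖p.2‖ ^ 2) * I R p.2 p.1 := h1.mul hIc
  refine (integrable_prod_iff hc.aestronglyMeasurable).2
    ⟨Eventually.of_forall fun ω => (k2r_ref_ok0_Q_le hΘ hI hR ω).1, ?_⟩
  set B : ℝ := (∫ w : V3, (1 + ‖w‖) ^ 3 * globalMaxwellian w) *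
    ∫ v : V3, 4 * ((1 + ‖v‖ ^ 2) ^ 2 * Θ R v)
  refine (integrable_const B).mono'
    (hc.norm.stronglyMeasurable.integral_prod_right' (ν := (volume : Measure V3))).aestronglyMeasurable
    (Eventually.of_forall fun ω => ?_)
  obtain ⟨-, hnn, hle⟩ := k2r_ref_ok0_Q_le hΘ hI hR ω
  have heq : (∫ U : V3, ‖(1 + ‖U‖ ^ 2) * I R U ω‖) =
      ∫ U : V3, (1 + ‖U‖ ^ 2) * I R U ω :=
    integral_congr_ae (Eventually.of_forall fun U =>
      Real.norm_of_nonneg (mul_nonneg (by positivity) (k2r_ref_ok0_I_nonneg hΘ hI hR ω U)))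
  show ‖∫ U : V3, ‖(1 + ‖U‖ ^ 2) * I R U ω‖‖ ≤ B
  rw [heq, Real.norm_of_nonneg hnn]
  exact hle

/-- **Weighted Fubini exchange on `S² × ℝ³`.** For a measurable `F` with `|F(U)| ≤ C_F(1+|U|²)`
and a bounded measurable weight `c` on the sphere: `c(ω) F(U) I₀^R(U, ω)` is integrable on
`σ ⊗ dU`, `U ↦ F(U) ∫ c I₀ dσ` is integrable, every `ω ↦ c(ω) I₀^R(U, ω)` is `σ`-integrable, and
`∫ c(ω) ∫ F I₀ dU dσ = ∫ F(U) ∫ c I₀ dσ dU`. [folklore] -/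
theorem k2r_ref_ok0_fubini_SV {R : ℝ} (hR : 1 ≤ R) {F : V3 → ℝ} (hF : Measurable F) {CF : ℝ}
    (hCF : ∀ U, |F U| ≤ CF * (1 + ‖U‖ ^ 2)) {c : Metric.sphere (0 : V3) 1 → ℝ} (hc : Measurable c)
    {cB : ℝ} (hcB : ∀ ω, |c ω| ≤ cB) :
    Integrable (fun p : Metric.sphere (0 : V3) 1 × V3 => c p.1 * (F p.2 * I R p.2 p.1))
      ((sphereMeasure : Measure (Metric.sphere (0 : V3) 1)).prod volume) ∧
    Integrable (fun U : V3 => F U * ∫ ω, c ω * I R U ω ∂sphereMeasure) ∧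
    (∀ U : V3, Integrable (fun ω => c ω * I R U ω)
      (sphereMeasure : Measure (Metric.sphere (0 : V3) 1))) ∧
    ∫ ω, c ω * (∫ U : V3, F U * I R U ω) ∂sphereMeasure =
      ∫ U : V3, F U * ∫ ω, c ω * I R U ω ∂sphereMeasure := by
  haveI := isFiniteMeasure_sphereMeasure (E := V3)
  have hR0 : 0 < R := by linarith
  have hCF0 : 0 ≤ CF := by
    have h := hCF 0
    rw [norm_zero] at h
    nlinarith [abs_nonneg (F 0)]
  obtain ⟨hIc, hIsec⟩ := k2r_ref_ok0_continuous_I' hI hR0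
  have hI0 : ∀ (ω : Metric.sphere (0 : V3) 1) (U : V3), 0 ≤ I R U ω :=
    fun ω U => k2r_ref_ok0_I_nonneg hΘ hI hR ω U
  have hIm : Measurable fun p : Metric.sphere (0 : V3) 1 × V3 => I R p.2 p.1 :=
    hIc.measurable
  set G : Metric.sphere (0 : V3) 1 × V3 → ℝ := fun p => c p.1 * (F p.2 * I R p.2 p.1)
    with hG
  have hGm : Measurable G := (hc.comp measurable_fst).mul ((hF.comp measurable_snd).mul hIm)
  have hGi : Integrable G ((sphereMeasure : Measure (Metric.sphere (0 : V3) 1)).prod volume) := by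
    refine ((k2r_ref_ok0_integrable_SV hΘ hI hR).const_mul (cB * CF)).mono' hGm.aestronglyMeasurable
      (Eventually.of_forall fun p => ?_)
    rw [Real.norm_eq_abs, hG]
    dsimp only
    rw [abs_mul, abs_mul, abs_of_nonneg (hI0 _ _)]
    calc |c p.1| * (|F p.2| * I R p.2 p.1)
        ≤ cB * (CF * (1 + ‖p.2‖ ^ 2) * I R p.2 p.1) := by
          have := hI0 p.1 p.2
          gcongr
          · exact (abs_nonneg _).trans (hcB p.1)
          · exact hcB p.1
          · exact hCF p.2
      _ = cB * CF * ((1 + ‖p.2‖ ^ 2) * I R p.2 p.1) := by ring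
  have hsec : ∀ U : V3, Integrable (fun ω => c ω * I R U ω)
      (sphereMeasure : Measure (Metric.sphere (0 : V3) 1)) := fun U =>
    (ClampedCorrectorBirth.integrable_sphere_of_continuous' (hIsec U)).bdd_mul hc.aestronglyMeasurable
      (Eventually.of_forall fun ω => by rw [Real.norm_eq_abs]; exact hcB ω)
  have hpull : ∀ U : V3, ∫ ω, G (ω, U) ∂sphereMeasure =
      F U * ∫ ω, c ω * I R U ω ∂sphereMeasure := fun U => by
    rw [← integral_const_mul]
    exact integral_congr_ae (Eventually.of_forall fun ω => by rw [hG]; dsimp only; ring)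
  refine ⟨hGi, hGi.integral_prod_right.congr (Eventually.of_forall hpull), hsec, ?_⟩
  calc ∫ ω, c ω * (∫ U : V3, F U * I R U ω) ∂sphereMeasure
      = ∫ ω, (∫ U : V3, G (ω, U)) ∂sphereMeasure :=
        integral_congr_ae (Eventually.of_forall fun ω => by beta_reduce; rw [← integral_const_mul])
    _ = ∫ p, G p ∂((sphereMeasure : Measure (Metric.sphere (0 : V3) 1)).prod volume) :=
        (integral_prod G hGi).symm
    _ = ∫ U : V3, ∫ ω, G (ω, U) ∂sphereMeasure := integral_prod_symm G hGi
    _ = ∫ U : V3, F U * ∫ ω, c ω * I R U ω ∂sphereMeasure :=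
        integral_congr_ae (Eventually.of_forall hpull)

/-- **The triple exchange.** For a jointly continuous `K(ω, U)` with `|K(ω, U)| ≤ C_K (1+|U|²)`:
`v ↦ Θ₀^R(v) ∫∫_{S²×ℝ³} ((v-w)·ω)₊ M(w) K(ω, w') d(σ⊗dw)` is integrable on `ℝ³` and
`∫ Θ₀^R(v) ∫∫ ((v-w)·ω)₊ M(w) K(ω, w') = ∫_{S²} ∫ K(ω, U) I₀^R(U, ω) dU dσ(ω)` (Fubini on `S² × ℝ³ × ℝ³`,
domination by `4C_K (1+|v|²)²Θ₀^R(v) · (1+|w|)³M(w)`, then the duality per direction).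
[cite: CIP1994, §3.1 (1.7)–(1.9)] -/
theorem k2r_ref_ok0_triple {R : ℝ} (hR : 1 ≤ R) {K : Metric.sphere (0 : V3) 1 → V3 → ℝ}
    (hK : Continuous (uncurry K)) {CK : ℝ} (hKb : ∀ ω U, |K ω U| ≤ CK * (1 + ‖U‖ ^ 2)) :
    Integrable (fun v : V3 => Θ R v *
      ∫ p : Metric.sphere (0 : V3) 1 × V3, max ⟪v - p.2, (p.1 : V3)⟫_ℝ 0 * globalMaxwellian p.2 *
        K p.1 (p.2 + ⟪v - p.2, (p.1 : V3)⟫_ℝ • (p.1 : V3))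
        ∂((sphereMeasure : Measure (Metric.sphere (0 : V3) 1)).prod volume)) ∧
    ∫ v : V3, Θ R v *
      ∫ p : Metric.sphere (0 : V3) 1 × V3, max ⟪v - p.2, (p.1 : V3)⟫_ℝ 0 * globalMaxwellian p.2 *
        K p.1 (p.2 + ⟪v - p.2, (p.1 : V3)⟫_ℝ • (p.1 : V3))
        ∂((sphereMeasure : Measure (Metric.sphere (0 : V3) 1)).prod volume) =
    ∫ ω, (∫ U : V3, K ω U * I R U ω) ∂sphereMeasure := by
  haveI := isFiniteMeasure_sphereMeasure (E := V3)
  have hCK : 0 ≤ CK := by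
    have h := hKb ⟨EuclideanSpace.single 0 1, by simp⟩ 0
    rw [norm_zero] at h
    nlinarith [abs_nonneg (K ⟨EuclideanSpace.single 0 1, by simp⟩ 0)]
  obtain ⟨hw01, hwc, hw2, -⟩ := k2r_ref_ok0_w_facts hΘ hR
  have hK' : ∀ {X : Type} [TopologicalSpace X] {f : X → Metric.sphere (0 : V3) 1} {g : X → V3},
      Continuous f → Continuous g → Continuous fun x => K (f x) (g x) :=
    fun hf hg => hK.comp (hf.prodMk hg)
  have hM := continuous_globalMaxwellian (E := V3)
  -- the integrand on `S² × (ℝ³ × ℝ³)`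
  set H : Metric.sphere (0 : V3) 1 × (V3 × V3) → ℝ := fun p => Θ R p.2.1 *
    (max ⟪p.2.1 - p.2.2, (p.1 : V3)⟫_ℝ 0 * globalMaxwellian p.2.2 *
      K p.1 (p.2.2 + ⟪p.2.1 - p.2.2, (p.1 : V3)⟫_ℝ • (p.1 : V3))) with hH
  have hin : Continuous fun p : Metric.sphere (0 : V3) 1 × (V3 × V3) =>
      ⟪p.2.1 - p.2.2, (p.1 : V3)⟫_ℝ := by fun_prop
  have hHc : Continuous H :=
    (hwc.comp continuous_snd.fst).mul (((hin.max continuous_const).mul (hM.comp continuous_snd.snd)).mul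
      (hK' continuous_fst (continuous_snd.snd.add (hin.smul (continuous_subtype_val.comp continuous_fst)))))
  -- domination and integrability on the triple product
  have hW : Integrable (fun w : V3 => (1 + ‖w‖) ^ 3 * globalMaxwellian w) :=
    Literature.Analysis.UnboundedOperators.integrable_one_add_norm_pow_mul_globalMaxwellian 3
  have hD : Integrable (fun q : V3 × V3 => 4 * CK * (((1 + ‖q.1‖ ^ 2) ^ 2 * Θ R q.1) *
      ((1 + ‖q.2‖) ^ 3 * globalMaxwellian q.2))) ((volume : Measure V3).prod volume) :=
    (hw2.mul_prod hW).const_mul (4 * CK)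
  have hHi : Integrable H ((sphereMeasure : Measure (Metric.sphere (0 : V3) 1)).prod
      ((volume : Measure V3).prod volume)) := by
    refine (hD.comp_snd sphereMeasure).mono' hHc.aestronglyMeasurable (Eventually.of_forall fun p => ?_)
    obtain ⟨ω, v, w⟩ := p
    rw [Real.norm_eq_abs, hH]
    dsimp only
    have hx : |K ω (w + ⟪v - w, (ω : V3)⟫_ℝ • (ω : V3))| ≤ CK * (1 + ‖v‖ ^ 2 + ‖w‖ ^ 2) :=
      (hKb _ _).trans (mul_le_mul_of_nonneg_left (by linarith [(k2r_ref_ko_norm_sq_out_le v w ω).2]) hCK)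
    have hp := k2r_ref_ko_piece_abs_le v w ω hCK hx
    have h4 := k2r_ref_ok0_cube_le (norm_nonneg v)
    have hMw : 0 ≤ (1 + ‖w‖) ^ 3 * globalMaxwellian w :=
      mul_nonneg (pow_nonneg (by positivity) 3) (globalMaxwellian_pos w).le
    rw [abs_mul, abs_of_nonneg (hw01 v).1]
    calc Θ R v * |max ⟪v - w, (ω : V3)⟫_ℝ 0 * globalMaxwellian w *
          K ω (w + ⟪v - w, (ω : V3)⟫_ℝ • (ω : V3))|
        ≤ Θ R v * (CK * (1 + ‖v‖) ^ 3 * ((1 + ‖w‖) ^ 3 * globalMaxwellian w)) :=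
          mul_le_mul_of_nonneg_left hp (hw01 v).1
      _ ≤ Θ R v * (CK * (4 * (1 + ‖v‖ ^ 2) ^ 2) * ((1 + ‖w‖) ^ 3 * globalMaxwellian w)) := by
          gcongr
          exact (hw01 v).1
      _ = 4 * CK * (((1 + ‖v‖ ^ 2) ^ 2 * Θ R v) * ((1 + ‖w‖) ^ 3 * globalMaxwellian w)) := by
          ring
  -- per direction: integrability on `ℝ³ × ℝ³` and the duality
  have hω : ∀ ω : Metric.sphere (0 : V3) 1,
      Integrable (fun q : V3 × V3 => H (ω, q)) ((volume : Measure V3).prod volume) ∧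
      ∫ v : V3, ∫ w : V3, H (ω, (v, w)) = ∫ U : V3, K ω U * I R U ω := by
    intro ω
    obtain ⟨h1, -, h3, -⟩ := k2r_ref_ok0_duality hΘ hI hR ω (F := K ω)
      (hK' continuous_const continuous_id).measurable (hKb ω)
    refine ⟨h1, ?_⟩
    rw [← h3]
    refine integral_congr_ae (Eventually.of_forall fun v => ?_)
    beta_reduce
    rw [← integral_const_mul]
  have hE1 : ∫ p, H p ∂((sphereMeasure : Measure (Metric.sphere (0 : V3) 1)).prod
      ((volume : Measure V3).prod volume)) =
      ∫ ω, (∫ U : V3, K ω U * I R U ω) ∂sphereMeasure := by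
    rw [integral_prod H hHi]
    refine integral_congr_ae (Eventually.of_forall fun ω => ?_)
    beta_reduce
    rw [← (hω ω).2]
    exact integral_prod _ (hω ω).1
  have hE2 : ∫ p, H p ∂((sphereMeasure : Measure (Metric.sphere (0 : V3) 1)).prod
      ((volume : Measure V3).prod volume)) =
      ∫ v : V3, ∫ w : V3, ∫ ω, H (ω, (v, w)) ∂sphereMeasure := by
    rw [integral_prod_symm H hHi]
    exact integral_prod _ hHi.integral_prod_right
  -- per velocity: the bracket piece is the `w`-then-`ω` iterated integral of `H`
  have hE3 : ∀ v : V3, Θ R v *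
      ∫ p : Metric.sphere (0 : V3) 1 × V3, max ⟪v - p.2, (p.1 : V3)⟫_ℝ 0 * globalMaxwellian p.2 *
        K p.1 (p.2 + ⟪v - p.2, (p.1 : V3)⟫_ℝ • (p.1 : V3))
        ∂((sphereMeasure : Measure (Metric.sphere (0 : V3) 1)).prod volume) =
      ∫ w : V3, ∫ ω, H (ω, (v, w)) ∂sphereMeasure := by
    intro v
    have hpi : Integrable (fun p : Metric.sphere (0 : V3) 1 × V3 =>
        max ⟪v - p.2, (p.1 : V3)⟫_ℝ 0 * globalMaxwellian p.2 *
          K p.1 (p.2 + ⟪v - p.2, (p.1 : V3)⟫_ℝ • (p.1 : V3)))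
        ((sphereMeasure : Measure (Metric.sphere (0 : V3) 1)).prod volume) :=
      k2r_ref_ko_integrable_piece (G := fun p => K p.1 (p.2 + ⟪v - p.2, (p.1 : V3)⟫_ℝ • (p.1 : V3)))
        (hK' continuous_fst (by fun_prop)) hCK v fun p => (hKb _ _).trans
          (mul_le_mul_of_nonneg_left (by linarith [(k2r_ref_ko_norm_sq_out_le v p.2 p.1).2]) hCK)
    rw [integral_prod_symm _ hpi, ← integral_const_mul]
    refine integral_congr_ae (Eventually.of_forall fun w => ?_)
    beta_reduce
    rw [← integral_const_mul]
  refine ⟨?_, ?_⟩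
  · rw [show (fun v : V3 => Θ R v *
        ∫ p : Metric.sphere (0 : V3) 1 × V3, max ⟪v - p.2, (p.1 : V3)⟫_ℝ 0 * globalMaxwellian p.2 *
          K p.1 (p.2 + ⟪v - p.2, (p.1 : V3)⟫_ℝ • (p.1 : V3))
          ∂((sphereMeasure : Measure (Metric.sphere (0 : V3) 1)).prod volume)) =
        fun v : V3 => ∫ w : V3, ∫ ω, H (ω, (v, w)) ∂sphereMeasure from funext hE3]
    exact hHi.integral_prod_right.integral_prod_left
  · rw [← hE1, hE2]
    exact integral_congr_ae (Eventually.of_forall hE3)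

omit hΘ hI in
/-- **Registered keyed sub-goal `stub_operatorKappaZero_prep`** of stub `stub_operatorKappaZero` (line
`refutation` of crux K2R): the cubic Taylor remainder `|sin y − y| ≤ |y|³/6` of the sine, used to
linearise the delocalisation phase `sin(2πε ω₀)`. [folklore] -/
theorem stub_operatorKappaZero_prep : ∀ y : ℝ, |Real.sin y - y| ≤ |y| ^ 3 / 6 := by
  intro y
  rcases le_or_gt 0 y with hy | hy
  · rw [abs_of_nonneg hy, abs_of_nonpos (by linarith [Real.sin_le hy])]
    linarith [Real.sin_ge_sub_cube hy]
  · have hy' : 0 ≤ -y := by linarith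
    have h1 := Real.sin_le hy'
    have h2 := Real.sin_ge_sub_cube hy'
    rw [Real.sin_neg] at h1 h2
    rw [abs_of_neg hy, abs_of_nonneg (by linarith)]
    nlinarith

end Summit.AtomisticToContinuum.HydrodynamicLimit.Theorems.EnskogAdjointDuality
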